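import Literature.MathematicalPhysics.QuantumFieldTheory.Balaban1983to89.B9Eq388KhCommutatorWeighted

/-!
# `Balaban1983to89.B9Eq388KhCommutatorWeightedExp` — T. Bałaban, *Propagators for lattice gauge theories in a background field*, Commun. Math. Phys.
# **99** (1985) 389–434 [Balaban1985BackgroundPropagators] (3.88)–(3.89) p. 409, (3.49) p. 399, (3.100) p. 413, (3.102) p. 414: **PRINT's `K(h)` AGAINST
# EXPONENTIAL WEIGHTS — THE `e^{−κr}` OF S-P6′(β)'s WEIGHTED LETTERS MADE EXPLICIT**: for a cutoff `σ` with UNIFORM profile letters (`|σ(b₋) − σ(b₊)| ≤ θ₁`,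
# `|Δ²_μσ(y)| ≤ θ₂`, `|σ − 1| ≤ τ₀`, `|χ′(y) − χ(x)| ≤ ϑ` on blocks) whose increments ∕ defect are SUPPORTED where a rate function `ρ ≥ r` (the collar), and the
# weights `W = e^{κρ}`, `W_E = e^{κρ_E}` (`κ ≥ 0`): `‖D*(D(Θf)) − Θ(D*(Df))‖ ≤ √d‖c′‖θ₁e^{−κr}(M_T + 1)·‖W_E(Df)‖ + d‖c′‖‖c‖θ₂e^{−κr}·‖Wf‖`,
# `‖Θf − f‖ ≤ τ₀e^{−κr}‖Wf‖`, `‖T(χ_Sλ) − χ_G(Tλ)‖ ≤ M_Aϑe^{−κr}‖Wλ‖` — the letters `a₁, a₀, τ, b₀` of `B9Eq387CubeLocalisedProjection.norm_sub_projR_cube_le_weighted`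
# with the smallness `e^{−κr}` DISPLAYED (the sequel of this lineage's `B9Eq388KhCommutatorWeighted`, whose §6 extraction is composed with its §§3–5 here)

statement-level skeleton of published theorems with citation tags; proofs where landed; nothing here is a claim about the Yang–Mills mass gap

CITATION HEADER (lean-in-tree rule).  Audit cell `pub-balaban`, sub-cell `t4`, BINDER row NE9; filed by NE9 formalisation-swarm leaf prover 05
(`b2b-balaban-t4-ne9-formalise-leaf-05`, gen 75).  CONSUMER BY SHAPE: ne9-leaf-06's `B9Eq387CubeLocalisedProjection.norm_sub_projR_cube_le_weighted` (route R2′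
STEP B8′ S-P6′(β), weighted form; `t4/ROUTES-NE9.md` v13.34 ADDENDUM (iv)(b) «letters against `e^{κχ}`»): its `hτ`, `ha`, `hb` at `W := e^{κρ}·`, `W_E := e^{κρ_E}·`
read `τ = τ₀e^{−κr}`, `a₁ = √d‖c′‖θ₁e^{−κr}(M_T + 1)`, `a₀ = d‖c′‖‖c‖θ₂e^{−κr}`, `b₀ = M_Aϑe^{−κr}` — so `ε_M = C_R(τ + a₁C_{DG} + (a₀ + C_Ψb₀)C_G) = O(e^{−κr})`
once `C_R, C_G, C_{DG}` (the conjugated projection ∕ Green's function letters — `B9Eq349ConjugatedProjection`, `B9Eq349ConjugatedGreenLetters`, NOT here) are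
bounded in the window `κ < κ₁`.  Source READ in the held text (`paper:balaban1985-cmp99-background-propagators`): p. 409 (3.89) *«|(K(h_□)G′_□h_□λ)(x)| ≤
O(M⁻¹)e^{−δ₀…}|λ|»*; p. 399 (3.49) (exponential decay `e^{−δ|x−y|}` of the kernels); p. 413 (3.100), p. 414 (3.102) (the commutators are first-order with
coefficients `∂h`).
WHY.  The weighted file states the letters for pointwise-dominated increments (`|δσ| ≤ θ·w`); a consumer's cutoff comes with UNIFORM letters and a
SUPPORT (the increments live on the collar `{ρ ≥ r}`), and the passage is `|δ| ≤ θ`, `δ ≠ 0 → r ≤ ρ` ⟹ `|δ| ≤ θe^{−κr}·e^{κρ}` (`abs_le_mul_exp_of_support`).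
This file does that composition once, so that the junction line reads the four letters with `e^{−κr}` off ONE theorem each.
WHAT IS PROVED (sorry-free; proof lane — no `def`; [folklore] the weighted file BY NAME + its §6 order facts; nothing of [B9] asserted):
§1 **`norm_lap_comm_le_exp`** (`a₁`, `a₀`); §2 **`norm_mul_sub_self_le_exp`** (`τ`); §3 **`norm_comm_T_le_exp`**, **`norm_comm_T_le_exp_diagonal`** (`b₀`);
§4 `exp_bpos_le_exp_step` (the bond weight `ρ_E := ρ∘bpos` against the site weight at the far end, one step `e^{κℓ}`) and the non-vacuity `example` (`κ = 0`:
the uniform letters come back).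
HONEST SCOPE.  Composition only; the cutoff `σ`, the rate `ρ` (e.g. a scaled distance to the cube — ne9-leaf-01's `B9Eq349BlockDistanceWeight` shape), `κ`,
`r` and the four support facts are the consumer's data; `C_R`, `C_G`, `C_{DG}`, `C_Ψ` NOT here; no decay of [B9] asserted; NOT NE9 (cell pub-balaban: NE9 NOT
PRINTED ∕ NOT PROVED; «NE9 ⇐ the named binders»; spine PROVED 0∕9; rung (B)+1 on a finite T⁴ — NOT infinite volume, NOT mass gap, NOT Clay; HONEST DEPENDENCY:
continuum YM on T⁴ ⇐ BetaPertH ∧ nine spine estimates (0/9 proved); BetaPertH ⇐ (D1) ∧ (D4) ∧ CAP+tail; G-an2-4 gates asym, D1 and NE2/3/4).  NEW file; nothing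
modified.  Net new unproved facts: 0.
-/

noncomputable section

namespace Literature.MathematicalPhysics.QuantumFieldTheory.Balaban1983to89.B9Eq388KhCommutatorWeightedExp

open B4Sect5Torus (TSite)
open B9SectCLatticeCarrier (Bond bpos btgt shift unshift)
open B9Eq311L2Pairing (WL2)
open B11Eq103H1Complex (SiteL2K BondL2K covDerivL2K covDivL2K)
open B9Eq323Ker (pathTr)
open B9Eq319QprimeTorus (fineP centre contour stepTransport QprimeLin)
open B9Eq388KhCommutatorWeighted (norm_lap_comm_le_weighted norm_mul_sub_self_le_weighted norm_comm_T_le_weighted norm_comm_T_le_weighted_diagonal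
  abs_le_mul_exp_of_support exp_weight_step_le)

/-! ## §1 The `ha` letter against `e^{κρ}`: `a₁ = √d‖c′‖θ₁e^{−κr}(M_T + 1)`, `a₀ = d‖c′‖‖c‖θ₂e^{−κr}` -/
section Lap
variable {𝕜 : Type*} [RCLike 𝕜] {d : ℕ} {Pd : Fin d → ℕ} {W : Type*} [NormedAddCommGroup W] [InnerProductSpace 𝕜 W]
  {c₀ : ℝ} [Fact (0 < c₀)] {R S : Bond d Pd → W →ₗ[𝕜] W} {MT : ℝ}

/-- **PRINT's `K(h)` FOR `D*D` AGAINST EXPONENTIAL WEIGHTS**: a cutoff `σ` with UNIFORM first ∕ second difference letters `θ₁`, `θ₂` whose increments are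
SUPPORTED on the collar (`σ(b₋) ≠ σ(b₊) → r ≤ ρ_E(b)`, `Δ²_μσ(y) ≠ 0 → r ≤ ρ(y)`), weights `W = e^{κρ}·`, `W_E = e^{κρ_E}·` (`0 ≤ κ`), transporters `‖S_b‖ ≤ M_T`,
`S_b∘R_b = 1`: `‖D*(D(Θf)) − Θ(D*(Df))‖ ≤ √d‖c′‖(θ₁e^{−κr})(M_T + 1)·‖W_E(Df)‖ + d‖c′‖‖c‖(θ₂e^{−κr})·‖Wf‖` — the `ha` of
`B9Eq387CubeLocalisedProjection.norm_sub_projR_cube_le_weighted` with the smallness displayed. [folklore] [cite: Balaban1985BackgroundPropagators, (3.88)–(3.89) p.409, (3.100) p.413, (3.49) p.399] -/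
theorem norm_lap_comm_le_exp (hMT : 0 ≤ MT) (hS : ∀ b v, ‖S b v‖ ≤ MT * ‖v‖) (hSR : ∀ b v, S b (R b v) = v)
    {σ ρ : TSite d Pd → ℝ} {ρE : Bond d Pd → ℝ} {θ₁ θ₂ κ r : ℝ} (hθ₁ : 0 ≤ θ₁) (hθ₂ : 0 ≤ θ₂) (hκ : 0 ≤ κ)
    (h1 : ∀ b : Bond d Pd, |σ (bpos b) - σ (btgt b)| ≤ θ₁) (h1s : ∀ b : Bond d Pd, σ (bpos b) ≠ σ (btgt b) → r ≤ ρE b)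
    (h2 : ∀ (y : TSite d Pd) (μ : Fin d), |(σ y - σ (unshift μ y)) - (σ (shift μ y) - σ y)| ≤ θ₂)
    (h2s : ∀ (y : TSite d Pd) (μ : Fin d), (σ y - σ (unshift μ y)) - (σ (shift μ y) - σ y) ≠ 0 → r ≤ ρ y)
    (Θ Wm : SiteL2K 𝕜 d Pd c₀ W → SiteL2K 𝕜 d Pd c₀ W) (ΘB WEm : BondL2K 𝕜 d Pd c₀ W → BondL2K 𝕜 d Pd c₀ W)
    (hΘ : ∀ (f : SiteL2K 𝕜 d Pd c₀ W) (x : TSite d Pd), WL2.equiv 𝕜 _ W (Θ f) x = (σ x : 𝕜) • WL2.equiv 𝕜 _ W f x)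
    (hΘB : ∀ (A : BondL2K 𝕜 d Pd c₀ W) (b : Bond d Pd), WL2.equiv 𝕜 _ W (ΘB A) b = (σ (bpos b) : 𝕜) • WL2.equiv 𝕜 _ W A b)
    (hWm : ∀ (f : SiteL2K 𝕜 d Pd c₀ W) (x : TSite d Pd), WL2.equiv 𝕜 _ W (Wm f) x = (Real.exp (κ * ρ x) : 𝕜) • WL2.equiv 𝕜 _ W f x)
    (hWEm : ∀ (A : BondL2K 𝕜 d Pd c₀ W) (b : Bond d Pd), WL2.equiv 𝕜 _ W (WEm A) b = (Real.exp (κ * ρE b) : 𝕜) • WL2.equiv 𝕜 _ W A b)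
    (c c' : 𝕜) (f : SiteL2K 𝕜 d Pd c₀ W) :
    ‖covDivL2K 𝕜 c₀ c' S (covDerivL2K 𝕜 c₀ c R (Θ f)) - Θ (covDivL2K 𝕜 c₀ c' S (covDerivL2K 𝕜 c₀ c R f))‖ ≤
      Real.sqrt d * ‖c'‖ * (θ₁ * Real.exp (-(κ * r))) * (MT + 1) * ‖WEm (covDerivL2K 𝕜 c₀ c R f)‖ +
        d * ‖c'‖ * ‖c‖ * (θ₂ * Real.exp (-(κ * r))) * ‖Wm f‖ :=
  norm_lap_comm_le_weighted hMT hS hSR (w := fun x => Real.exp (κ * ρ x)) (wE := fun b => Real.exp (κ * ρE b)) (by positivity) (by positivity)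
    (fun _ => (Real.exp_pos _).le) (fun _ => (Real.exp_pos _).le)
    (fun b => abs_le_mul_exp_of_support (h1 b) hθ₁ hκ fun hne => h1s b (sub_ne_zero.1 hne))
    (fun y μ => abs_le_mul_exp_of_support (h2 y μ) hθ₂ hκ (h2s y μ)) Θ Wm ΘB WEm hΘ hΘB hWm hWEm c c' f

end Lap

/-! ## §2 The `hτ` letter against `e^{κρ}`: `τ = τ₀e^{−κr}` -/
section Tail
variable {𝕜 : Type*} [RCLike 𝕜] {X V : Type*} [Fintype X] [NormedAddCommGroup V] [InnerProductSpace 𝕜 V] {wt : X → ℝ} [Fact (∀ x, 0 < wt x)]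

/-- **THE CUTOFF TAIL AGAINST `e^{κρ}`**: `|σ(x) − 1| ≤ τ₀` everywhere (`τ₀ = 1` for `0 ≤ σ ≤ 1`), `σ(x) ≠ 1 → r ≤ ρ(x)` (the cutoff is `1` off the collar),
`W = e^{κρ}·` (`0 ≤ κ`): `‖Θf − f‖ ≤ τ₀e^{−κr}·‖Wf‖` — the `hτ` of `norm_sub_projR_cube_le_weighted`. [folklore] [cite: Balaban1985BackgroundPropagators, (3.89) p.409, (3.49) p.399] -/
theorem norm_mul_sub_self_le_exp {σ ρ : X → ℝ} {τ₀ κ r : ℝ} (hτ₀ : 0 ≤ τ₀) (hκ : 0 ≤ κ) (hστ : ∀ x, |σ x - 1| ≤ τ₀)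
    (hs : ∀ x, σ x ≠ 1 → r ≤ ρ x) (Θ Wm : WL2 𝕜 wt V → WL2 𝕜 wt V)
    (hΘ : ∀ (f : WL2 𝕜 wt V) (x : X), WL2.equiv 𝕜 wt V (Θ f) x = (σ x : 𝕜) • WL2.equiv 𝕜 wt V f x)
    (hWm : ∀ (f : WL2 𝕜 wt V) (x : X), WL2.equiv 𝕜 wt V (Wm f) x = (Real.exp (κ * ρ x) : 𝕜) • WL2.equiv 𝕜 wt V f x) (f : WL2 𝕜 wt V) :
    ‖Θ f - f‖ ≤ τ₀ * Real.exp (-(κ * r)) * ‖Wm f‖ :=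
  norm_mul_sub_self_le_weighted (w := fun x => Real.exp (κ * ρ x)) (by positivity) (fun _ => (Real.exp_pos _).le)
    (fun x => abs_le_mul_exp_of_support (hστ x) hτ₀ hκ fun hne => hs x (sub_ne_zero.1 hne)) Θ Wm hΘ hWm f

end Tail

/-! ## §3 The `hb` letter against `e^{κρ}`: `b₀ = M_Aϑe^{−κr}` -/
section Bzero
variable {d : ℕ} (L : ℕ) [NeZero L] (m : Fin d → ℕ) {W : Type*} [NormedAddCommGroup W] [InnerProductSpace ℂ W] {c₀ c₁ : ℝ}
  [Fact (0 < c₀)] [Fact (0 < c₁)] {Rb : Bond d (fineP L m) → W →ₗ[ℂ] W} {MA : ℝ}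
  (hA : ∀ (y : TSite d m), ∀ x ∈ B9Eq319QprimeTorus.blockOf L m y, ∀ v : W,
    ‖pathTr (stepTransport L m fun b => (Rb b).restrictScalars ℝ) (centre L m y :: contour L m x) v‖ ≤ MA * ‖v‖)
  (T : SiteL2K ℂ d (fineP L m) c₀ W → WL2 ℂ (fun _ : TSite d m => c₁) W)
  (hT : ∀ (f : SiteL2K ℂ d (fineP L m) c₀ W) (y : TSite d m),
    WL2.equiv ℂ (fun _ : TSite d m => c₁) W (T f) y = QprimeLin L m Rb (WL2.equiv ℂ (fun _ : TSite d (fineP L m) => c₀) W f) y)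
  {χ' : TSite d m → ℝ} {χ ρ : TSite d (fineP L m) → ℝ} {ϑ κ r : ℝ}
  (χS Wm : SiteL2K ℂ d (fineP L m) c₀ W → SiteL2K ℂ d (fineP L m) c₀ W) (χG : WL2 ℂ (fun _ : TSite d m => c₁) W → WL2 ℂ (fun _ : TSite d m => c₁) W)
  (hS : ∀ (f : SiteL2K ℂ d (fineP L m) c₀ W) (x : TSite d (fineP L m)),
    WL2.equiv ℂ (fun _ : TSite d (fineP L m) => c₀) W (χS f) x = (χ x : ℂ) • WL2.equiv ℂ (fun _ : TSite d (fineP L m) => c₀) W f x)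
  (hWm : ∀ (f : SiteL2K ℂ d (fineP L m) c₀ W) (x : TSite d (fineP L m)),
    WL2.equiv ℂ (fun _ : TSite d (fineP L m) => c₀) W (Wm f) x = (Real.exp (κ * ρ x) : ℂ) • WL2.equiv ℂ (fun _ : TSite d (fineP L m) => c₀) W f x)
  (hG : ∀ (g : WL2 ℂ (fun _ : TSite d m => c₁) W) (y : TSite d m),
    WL2.equiv ℂ (fun _ : TSite d m => c₁) W (χG g) y = (χ' y : ℂ) • WL2.equiv ℂ (fun _ : TSite d m => c₁) W g y)

include hA hT hS hWm hG in
/-- **THE `Q′` COMMUTATOR AGAINST `e^{κρ}`**: block oscillation `|χ′(y) − χ(x)| ≤ ϑ` on `x ∈ B(y)`, SUPPORTED on the collar (`χ′(y) ≠ χ(x) → r ≤ ρ(x)`),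
`W = e^{κρ}·`, transports `≤ M_A`: `‖T(χ_Sλ) − χ_G(Tλ)‖ ≤ M_A(ϑe^{−κr})√(c₁(c₀L^d)⁻¹)·‖Wλ‖`. [folklore] [cite: Balaban1985BackgroundPropagators, (3.102) p.414, (3.89) p.409] -/
theorem norm_comm_T_le_exp (hMA : 0 ≤ MA) (hϑ : 0 ≤ ϑ) (hκ : 0 ≤ κ)
    (hb : ∀ (y : TSite d m), ∀ x ∈ B9Eq319QprimeTorus.blockOf L m y, |χ' y - χ x| ≤ ϑ)
    (hbs : ∀ (y : TSite d m), ∀ x ∈ B9Eq319QprimeTorus.blockOf L m y, χ' y ≠ χ x → r ≤ ρ x) (f : SiteL2K ℂ d (fineP L m) c₀ W) :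
    ‖T (χS f) - χG (T f)‖ ≤ MA * (ϑ * Real.exp (-(κ * r))) * Real.sqrt (c₁ * (c₀ * (L : ℝ) ^ d)⁻¹) * ‖Wm f‖ :=
  norm_comm_T_le_weighted L m hA T hT χS Wm χG hS hWm hG hMA (by positivity) (fun _ => (Real.exp_pos _).le)
    (fun y x hx => abs_le_mul_exp_of_support (hb y x hx) hϑ hκ fun hne => hbs y x hx (sub_ne_zero.1 hne)) f

include hA hT hS hWm hG in
/-- **`b₀ = M_Aϑe^{−κr}` AT THE DIAGONAL `c₁ = L^dc₀`** — the `hb` of `norm_sub_projR_cube_le_weighted` with the smallness displayed: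
`‖T(χ_Sλ) − χ_G(Tλ)‖ ≤ M_A(ϑe^{−κr})·‖Wλ‖`. [folklore] [cite: Balaban1985BackgroundPropagators, (3.102) p.414, (3.89) p.409, (3.49) p.399] -/
theorem norm_comm_T_le_exp_diagonal (hMA : 0 ≤ MA) (hϑ : 0 ≤ ϑ) (hκ : 0 ≤ κ)
    (hb : ∀ (y : TSite d m), ∀ x ∈ B9Eq319QprimeTorus.blockOf L m y, |χ' y - χ x| ≤ ϑ)
    (hbs : ∀ (y : TSite d m), ∀ x ∈ B9Eq319QprimeTorus.blockOf L m y, χ' y ≠ χ x → r ≤ ρ x) (hc : c₁ = (L : ℝ) ^ d * c₀)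
    (f : SiteL2K ℂ d (fineP L m) c₀ W) : ‖T (χS f) - χG (T f)‖ ≤ MA * (ϑ * Real.exp (-(κ * r))) * ‖Wm f‖ :=
  norm_comm_T_le_weighted_diagonal L m hA T hT χS Wm χG hS hWm hG hMA (by positivity) (fun _ => (Real.exp_pos _).le)
    (fun y x hx => abs_le_mul_exp_of_support (hb y x hx) hϑ hκ fun hne => hbs y x hx (sub_ne_zero.1 hne)) hc f

end Bzero

/-! ## §4 Bond weight at `b₋` versus the site weight at `b₊`; non-vacuity at `κ = 0` -/
section Step
variable {d : ℕ} {Pd : Fin d → ℕ}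

/-- **THE BOND WEIGHT `ρ_E := ρ∘bpos` AGAINST THE FAR END**: if the rate `ρ` moves by at most `ℓ` along a bond and `0 ≤ κ`, then
`e^{κρ(b₊)} ≤ e^{κℓ}·e^{κρ(b₋)}` and `e^{κρ(b₋)} ≤ e^{κℓ}·e^{κρ(b₊)}` — the consumer's licence to read `W_E` at either end of the bond (cost `e^{κℓ}`,
`ℓ = (Lη)⁻¹`-type per fine bond for a block-scaled distance). [folklore] [cite: Balaban1985BackgroundPropagators, (3.49) p.399] -/
theorem exp_bpos_le_exp_step {ρ : TSite d Pd → ℝ} {κ ℓ : ℝ} (hκ : 0 ≤ κ) (hρ : ∀ b : Bond d Pd, |ρ (btgt b) - ρ (bpos b)| ≤ ℓ) (b : Bond d Pd) :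
    Real.exp (κ * ρ (btgt b)) ≤ Real.exp (κ * ℓ) * Real.exp (κ * ρ (bpos b)) ∧
      Real.exp (κ * ρ (bpos b)) ≤ Real.exp (κ * ℓ) * Real.exp (κ * ρ (btgt b)) :=
  ⟨exp_weight_step_le hκ (hρ b), exp_weight_step_le hκ (by rw [abs_sub_comm]; exact hρ b)⟩

end Step

section Sanity
variable {𝕜 : Type*} [RCLike 𝕜] {X V : Type*} [Fintype X] [NormedAddCommGroup V] [InnerProductSpace 𝕜 V] {wt : X → ℝ} [Fact (∀ x, 0 < wt x)]

/-- Non-vacuity: at `κ = 0` the weight is `1`, `W` may be taken to be the identity, the support condition is idle (take `r := 0`, `ρ := 0`), and the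
`hτ` letter returns the uniform `‖Θf − f‖ ≤ τ₀‖f‖`. [cite: Balaban1985BackgroundPropagators, (3.89) p.409] -/
example {σ : X → ℝ} {τ₀ : ℝ} (hτ₀ : 0 ≤ τ₀) (hστ : ∀ x, |σ x - 1| ≤ τ₀) (Θ : WL2 𝕜 wt V → WL2 𝕜 wt V)
    (hΘ : ∀ (f : WL2 𝕜 wt V) (x : X), WL2.equiv 𝕜 wt V (Θ f) x = (σ x : 𝕜) • WL2.equiv 𝕜 wt V f x) (f : WL2 𝕜 wt V) :
    ‖Θ f - f‖ ≤ τ₀ * ‖f‖ := by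
  have h := norm_mul_sub_self_le_exp (ρ := fun _ => (0 : ℝ)) (κ := 0) (r := 0) hτ₀ le_rfl hστ (fun _ _ => le_rfl) Θ id hΘ
    (fun f x => by simp) f
  simpa using h

end Sanity

end Literature.MathematicalPhysics.QuantumFieldTheory.Balaban1983to89.B9Eq388KhCommutatorWeightedExp

end
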